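import Summits.Parity.BatemanHorn.Theses.RoughParitySectors
import Summits.Parity.BatemanHorn.Theorems.BalancedSemiprimeLayer.Negative.FalseWithoutIrreducible

/-!
# `RoughParityBalance` (crux stmt-Parity-15627): which hypotheses of `IsBatemanHornSystem` are load-bearing

Negative-side load-bearing analysis (crux-attack vetting, refuter-rattack-stmt-Parity-15627-0), PROVED.
The crux `Summit.Parity.BatemanHorn.Theses.RoughParitySectors.RoughParityBalance` quantifies over
Bateman–Horn systems `f` (`IsBatemanHornSystem f`: irreducible, positive leading coefficients,
pairwise non-associated, no fixed prime divisor) and asserts `|2^k·c_odd(x,U) − #R_f(x,U)| ≤ δ·#R_f(x,U)`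
for `U ≥ U₀(δ)`, eventually in `x` (conclusion copied VERBATIM below).

* `roughParityBalance_false_without_irreducible`: with `irreducible` DROPPED the statement is false.
  Witness `(X²)` (positive leading coefficient, trivially pairwise non-associated, no fixed prime
  divisor): `Ω(n²) = 2·Ω(n)` is even, so the all-odd cell is EMPTY while `1 ∈ R` (`f(1) = 1` has no
  prime factor), i.e. `|0 − #R| = #R > #R/2`.  Irreducibility enters the crux through repeated factors
  (forced parity), exactly as for `BalancedSemiprimeLayer` (`hasNoFixedPrimeDivisor_X_sq` is reused).
* `roughParityBalance_false_without_hasNoFixedPrimeDivisor`: with `hasNoFixedPrimeDivisor` DROPPED the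
  statement is false.  Witness the CONSTANT system `(C 2)` (irreducible — `2` is prime in `ℤ[X]` —,
  leading coefficient `2 > 0`): `natDegree = 0` makes the sifting range `Finset.range ⌈x^0⌉₊ = {0}`
  empty of primes, so `R = [1, x]`, and `Ω(2) = 1` is odd, so `c_odd = R`: `|2·#R − #R| = #R > #R/2`.
  For NON-constant systems with a fixed prime divisor `q` the rough set is empty once the thresholds
  pass `q`, so that hypothesis is load-bearing only through constant members (it is what excludes them).
-/

namespace Summit.Parity.BatemanHorn.Theorems.RoughParityBalance.Negative

open Filter Finset Polynomial Real
open scoped Topology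
open Literature.NumberTheory.Sieve
open Summit.Parity.BatemanHorn.Theorems.BalancedSemiprimeLayer.Negative (hasNoFixedPrimeDivisor_X_sq)

/-- **Any proof of `RoughParityBalance` must use `irreducible`**: with that field of
`IsBatemanHornSystem` dropped (the other three kept, conclusion verbatim) the statement is false
(witness `(X²)`, `δ = 1/2`: the all-odd cell of the rough values of a square is empty). [folklore] -/
theorem roughParityBalance_false_without_irreducible :
    ¬ ∀ (k : ℕ) (f : Fin k → ℤ[X]), (∀ i, 0 < (f i).leadingCoeff) →
      (Pairwise fun i j => ¬Associated (f i) (f j)) → HasNoFixedPrimeDivisor f →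
        ∀ δ : ℝ, 0 < δ → ∃ U₀ : ℝ, ∀ U : ℝ, U₀ ≤ U → ∀ᶠ x : ℕ in atTop,
          |(2 : ℝ) ^ k * (((((Icc 1 x).filter (fun n : ℕ => ∀ i, 0 < (f i).eval (n : ℤ) ∧
              ∀ p ∈ range ⌈(x : ℝ) ^ (((f i).natDegree : ℝ) / U)⌉₊, p.Prime →
                ¬ ((p : ℤ) ∣ (f i).eval (n : ℤ)))).filter (fun n : ℕ => ∀ i,
              Odd (ArithmeticFunction.cardFactors (((f i).eval (n : ℤ)).toNat)))).card : ℕ) : ℝ) -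
            ((((Icc 1 x).filter (fun n : ℕ => ∀ i, 0 < (f i).eval (n : ℤ) ∧
              ∀ p ∈ range ⌈(x : ℝ) ^ (((f i).natDegree : ℝ) / U)⌉₊, p.Prime →
                ¬ ((p : ℤ) ∣ (f i).eval (n : ℤ)))).card : ℕ) : ℝ)| ≤
            δ * ((((Icc 1 x).filter (fun n : ℕ => ∀ i, 0 < (f i).eval (n : ℤ) ∧
              ∀ p ∈ range ⌈(x : ℝ) ^ (((f i).natDegree : ℝ) / U)⌉₊, p.Prime →
                ¬ ((p : ℤ) ∣ (f i).eval (n : ℤ)))).card : ℕ) : ℝ) := by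
  intro h
  have hlc : ∀ i, 0 < (![(X ^ 2 : ℤ[X])] i).leadingCoeff := by
    intro i; fin_cases i; simp
  obtain ⟨U₀, hU⟩ :=
    h 1 ![X ^ 2] hlc Subsingleton.pairwise hasNoFixedPrimeDivisor_X_sq (1 / 2) one_half_pos
  obtain ⟨x, hx1, hx⟩ := ((eventually_ge_atTop 1).and (hU U₀ le_rfl)).exists
  -- the all-odd cell of the rough values of `X²` is empty: `Ω(n²) = 2 Ω(n)`
  have hodd : ((Icc 1 x).filter (fun n : ℕ => ∀ i : Fin 1, 0 < (![(X ^ 2 : ℤ[X])] i).eval (n : ℤ) ∧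
      ∀ p ∈ range ⌈(x : ℝ) ^ (((![(X ^ 2 : ℤ[X])] i).natDegree : ℝ) / U₀)⌉₊, p.Prime →
        ¬ ((p : ℤ) ∣ (![(X ^ 2 : ℤ[X])] i).eval (n : ℤ)))).filter (fun n : ℕ => ∀ i : Fin 1,
          Odd (ArithmeticFunction.cardFactors (((![(X ^ 2 : ℤ[X])] i).eval (n : ℤ)).toNat))) = ∅ := by
    refine filter_false_of_mem fun n _ hn => ?_
    have h0 := hn 0
    rw [Matrix.cons_val_zero, eval_pow, eval_X, ← Nat.cast_pow, Int.toNat_natCast,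
      ArithmeticFunction.cardFactors_pow] at h0
    exact Nat.not_odd_iff_even.2 (even_two_mul _) h0
  -- `1` is a rough value (no prime divides `1`)
  have h1R : 1 ∈ (Icc 1 x).filter (fun n : ℕ => ∀ i : Fin 1, 0 < (![(X ^ 2 : ℤ[X])] i).eval (n : ℤ) ∧
      ∀ p ∈ range ⌈(x : ℝ) ^ (((![(X ^ 2 : ℤ[X])] i).natDegree : ℝ) / U₀)⌉₊, p.Prime →
        ¬ ((p : ℤ) ∣ (![(X ^ 2 : ℤ[X])] i).eval (n : ℤ))) := by
    rw [mem_filter]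
    refine ⟨mem_Icc.2 ⟨le_rfl, hx1⟩, Fin.forall_fin_one.2 ⟨by simp, fun p _ hp hdvd => hp.ne_one ?_⟩⟩
    rw [Matrix.cons_val_zero, eval_pow, eval_X, Nat.cast_one, one_pow] at hdvd
    exact_mod_cast Int.eq_one_of_dvd_one (by positivity) hdvd
  have hpos : (0 : ℝ) < ((((Icc 1 x).filter (fun n : ℕ => ∀ i : Fin 1,
      0 < (![(X ^ 2 : ℤ[X])] i).eval (n : ℤ) ∧
      ∀ p ∈ range ⌈(x : ℝ) ^ (((![(X ^ 2 : ℤ[X])] i).natDegree : ℝ) / U₀)⌉₊, p.Prime →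
        ¬ ((p : ℤ) ∣ (![(X ^ 2 : ℤ[X])] i).eval (n : ℤ)))).card : ℕ) : ℝ) := by
    exact_mod_cast card_pos.2 ⟨1, h1R⟩
  rw [hodd, card_empty, Nat.cast_zero, mul_zero, zero_sub, abs_neg, abs_of_pos hpos] at hx
  linarith

/-- **Any proof of `RoughParityBalance` must use `hasNoFixedPrimeDivisor`** — but only to exclude
CONSTANT members: with that field of `IsBatemanHornSystem` dropped (the other three kept, conclusion
verbatim) the statement is false, witness the constant system `(C 2)`, `δ = 1/2` (degree `0`: nothing
is sifted, `R = [1,x]`, and `Ω(2) = 1` puts every `n` in the all-odd cell). [folklore] -/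
theorem roughParityBalance_false_without_hasNoFixedPrimeDivisor :
    ¬ ∀ (k : ℕ) (f : Fin k → ℤ[X]), (∀ i, Irreducible (f i)) → (∀ i, 0 < (f i).leadingCoeff) →
      (Pairwise fun i j => ¬Associated (f i) (f j)) →
        ∀ δ : ℝ, 0 < δ → ∃ U₀ : ℝ, ∀ U : ℝ, U₀ ≤ U → ∀ᶠ x : ℕ in atTop,
          |(2 : ℝ) ^ k * (((((Icc 1 x).filter (fun n : ℕ => ∀ i, 0 < (f i).eval (n : ℤ) ∧
              ∀ p ∈ range ⌈(x : ℝ) ^ (((f i).natDegree : ℝ) / U)⌉₊, p.Prime →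
                ¬ ((p : ℤ) ∣ (f i).eval (n : ℤ)))).filter (fun n : ℕ => ∀ i,
              Odd (ArithmeticFunction.cardFactors (((f i).eval (n : ℤ)).toNat)))).card : ℕ) : ℝ) -
            ((((Icc 1 x).filter (fun n : ℕ => ∀ i, 0 < (f i).eval (n : ℤ) ∧
              ∀ p ∈ range ⌈(x : ℝ) ^ (((f i).natDegree : ℝ) / U)⌉₊, p.Prime →
                ¬ ((p : ℤ) ∣ (f i).eval (n : ℤ)))).card : ℕ) : ℝ)| ≤
            δ * ((((Icc 1 x).filter (fun n : ℕ => ∀ i, 0 < (f i).eval (n : ℤ) ∧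
              ∀ p ∈ range ⌈(x : ℝ) ^ (((f i).natDegree : ℝ) / U)⌉₊, p.Prime →
                ¬ ((p : ℤ) ∣ (f i).eval (n : ℤ)))).card : ℕ) : ℝ) := by
  intro h
  have hirr : ∀ i, Irreducible (![(C 2 : ℤ[X])] i) :=
    Fin.forall_fin_one.2 (by
      rw [Matrix.cons_val_zero]; exact (Polynomial.prime_C_iff.2 Int.prime_two).irreducible)
  have hlc : ∀ i, 0 < (![(C 2 : ℤ[X])] i).leadingCoeff :=
    Fin.forall_fin_one.2 (by rw [Matrix.cons_val_zero, leadingCoeff_C]; norm_num)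
  obtain ⟨U₀, hU⟩ := h 1 ![C 2] hirr hlc Subsingleton.pairwise (1 / 2) one_half_pos
  obtain ⟨x, hx1, hx⟩ := ((eventually_ge_atTop 1).and (hU U₀ le_rfl)).exists
  -- nothing is sifted: `R = [1, x]`
  have hR : (Icc 1 x).filter (fun n : ℕ => ∀ i : Fin 1, 0 < (![(C 2 : ℤ[X])] i).eval (n : ℤ) ∧
      ∀ p ∈ range ⌈(x : ℝ) ^ (((![(C 2 : ℤ[X])] i).natDegree : ℝ) / U₀)⌉₊, p.Prime →
        ¬ ((p : ℤ) ∣ (![(C 2 : ℤ[X])] i).eval (n : ℤ))) = Icc 1 x := by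
    refine filter_true_of_mem fun n _ => Fin.forall_fin_one.2 ⟨by simp, fun p hp hpp _ => ?_⟩
    rw [Matrix.cons_val_zero, natDegree_C, Nat.cast_zero, zero_div, Real.rpow_zero, Nat.ceil_one,
      range_one, mem_singleton] at hp
    exact Nat.not_prime_zero (hp ▸ hpp)
  -- every `n` is in the all-odd cell: `Ω(2) = 1`
  have hO : ((Icc 1 x).filter (fun n : ℕ => ∀ i : Fin 1, 0 < (![(C 2 : ℤ[X])] i).eval (n : ℤ) ∧
      ∀ p ∈ range ⌈(x : ℝ) ^ (((![(C 2 : ℤ[X])] i).natDegree : ℝ) / U₀)⌉₊, p.Prime →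
        ¬ ((p : ℤ) ∣ (![(C 2 : ℤ[X])] i).eval (n : ℤ)))).filter (fun n : ℕ => ∀ i : Fin 1,
          Odd (ArithmeticFunction.cardFactors (((![(C 2 : ℤ[X])] i).eval (n : ℤ)).toNat))) =
      (Icc 1 x).filter (fun n : ℕ => ∀ i : Fin 1, 0 < (![(C 2 : ℤ[X])] i).eval (n : ℤ) ∧
      ∀ p ∈ range ⌈(x : ℝ) ^ (((![(C 2 : ℤ[X])] i).natDegree : ℝ) / U₀)⌉₊, p.Prime →
        ¬ ((p : ℤ) ∣ (![(C 2 : ℤ[X])] i).eval (n : ℤ))) := by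
    refine filter_true_of_mem fun n _ => Fin.forall_fin_one.2 ?_
    rw [Matrix.cons_val_zero, eval_C]
    show Odd (ArithmeticFunction.cardFactors 2)
    rw [ArithmeticFunction.cardFactors_apply_prime Nat.prime_two]
    exact odd_one
  rw [hO, hR, Nat.card_Icc, Nat.add_sub_cancel, pow_one, two_mul, add_sub_cancel_right,
    abs_of_nonneg (Nat.cast_nonneg x)] at hx
  have hx' : (1 : ℝ) ≤ x := by exact_mod_cast hx1
  linarith

end Summit.Parity.BatemanHorn.Theorems.RoughParityBalance.Negative
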